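import Summits.AtomisticToContinuum.Crystallization.Theorems.ChartedZeroExcessLayeredLatticeLiouvilleZZO

/-!
# (B′.4a) rider ZZQ — CONE PINS, bridge (c1): the pin step

Lineage `stmt-AtomisticToContinuum-26636` (route ChartedPlanarOrder), lens-2 g81, cone-pin programme (B′) (critic row 1471 (C): «(c1a) → (c1) → …»).

★★ `pin_step`.  SETTING: `Ψ, τ` the global Barlow bond chart of the two-shell-clean `17/20`-separated `S` (tree ZZ), `Φ, τ'` a Barlow bond chart of `C`
on `D` (LEMMA C), `g` the partner map (`Ψ y` and `Φ (g y)` are `ε`-close), `Θ` a lattice map which near `x` is a Barlow ISOMORPHISM ON FIRST ARGUMENTS in a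
set `N ⊇` the three-step neighbourhood of `x` and LOCALLY ONTO links there (the slab isomorphism of (B′.4)), and `P` the set of PROCESSED sites, on which
`g = Θ` and the partner is charted.  HYPOTHESIS OF THE INDUCTION: every site whose atom lies in the `60°`-cone of `w = Ψ x − x₀` at `Ψ x` within the pin
reach `43/20` is processed.  CONCLUSION: `g x = Θ x`.

PROOF (all index-side; the geometry is rider ZZN `cell_at_site` + rider ZZO `competitor_cone`): the cell's first-shell members `x + m` are link sites of
`x`, in the cone within `17/16` ⇒ processed; its second-shell members `x + m'` are orthogonal two-step sites (ZZN `shell2_cover`), in the cone within `3/2`,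
at S-distance in the window `[9/10(√2 − 1/16), √2 + 1/16]` (tree ZZF `dist_window_of_secondShell`) ⇒ processed.  Tree ZZ `barlowAdj_partner` / ZZF
`barlowFour_partner` (C two-shell good at `Φ (g x)`, bonds there charted, the `four_window_record` inequalities as binders) make `g x` adjacent to
`Θ (x + m)` and Four-related to `Θ (x + m')` in the C-lattice.  Local surjectivity of `Θ` at a first-shell member (the member list is non-empty because the
cell passes — `cellSigma1_ne_nil`) gives `x⋆` with `Θ x⋆ = g x`; the isomorphism clauses pull the relations back: `x⋆` is adjacent to every `x + m` and
Four-related to every `x + m'` IN THE S-LATTICE (the four common neighbours are pulled back by local surjectivity at `x + m'`; they are link sites of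
`x + m'`, inside `N`).  Tree ZZG `pin_sound_abs` (the kernel-checked cell test) leaves `x⋆ = x` — done — or `x⋆ − x ∈ cellAllowed`, an allowed competitor:
then `competitor_cone` puts `Ψ x⋆` in the cone within `17/8 < 43/20`, so `x⋆` is processed, `g x⋆ = Θ x⋆ = g x`, and tree ZZ `eq_of_partner_eq`
(`17/20`-separation, `2ε < 17/20`) forces `x⋆ = x` anyway.

0 sorry.  No frames, scales or potentials of different atoms are compared; no new real-side estimate.
-/

open scoped RealInnerProductSpace
open Literature.Geometry.DiscreteGeometry (intVec sqNormInt dotInt IsTwoShellGoodSet)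

namespace Summit.AtomisticToContinuum.Crystallization.Theorems.ChartedZeroExcessLayeredLatticeLiouville

open Summit.AtomisticToContinuum.Crystallization.Theorems.ChartedPlanarOrderRigidityDoor (E3)

/-- a passing cell has a first-shell member (the pin checker rejects an empty first list). [formal bookkeeping] -/
theorem cellSigma1_ne_nil {a b c d : Bool} {cs : List (Fin 3 → ℤ)} (h : cellCheckB a b c d cs = true) :
    cellSigma1 (letters4 a b c d) cs ≠ [] := by
  intro he
  simp [cellCheckB, pinCheckB, he] at h

/-- an orthogonal pair of ideal link positions spans `√2`. [formal bookkeeping] -/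
theorem norm_iotaPt_add_of_orth {α β : Bool} {i j : Fin 12} (horth : dotInt (iotaTab α β i) (iotaTab α β j) = 0) :
    ‖iotaPt α β i + iotaPt α β j‖ = Real.sqrt 2 := by
  have h := (frame_second_data LinearIsometry.id 1 horth).1
  rw [one_smul, LinearIsometry.id_apply, one_pow, mul_one] at h
  rw [← Real.sqrt_sq (norm_nonneg (iotaPt α β i + iotaPt α β j)), h]

/-- ★★ THE PIN STEP (c1).  See the module docstring.  Binders: the S-chart and its record-type dials (`hsepS`, `hε`, `hgapS`, `hβS` as in tree ZZ), the
C-chart `hΦ` with two-shell goodness at the partner of `x`, charted bonds there and the window inequalities of tree ZZF `four_window_record` (`hbond`,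
`hlo`, `hlo'`, `hhi`), the processed set `P` (`hP`), the slab isomorphism `Θ` near `x` (`hiso` on first arguments in `N`, `hsurj` local surjectivity on
`N`, `hN1`–`hN3`: `N` contains the three-step neighbourhood of `x`), and the INDUCTION HYPOTHESIS `hcone`: the `60°`-cone of `Ψ x − x₀` at `Ψ x` within
`43/20` is processed. [this file, g81] -/
theorem pin_step {S C : Set E3} {D P N : Set (ℤ × ℤ × ℤ)} {Ψ Φ : ℤ × ℤ × ℤ → E3} {τ τ' : ℤ → Bool}
    {g Θ : ℤ × ℤ × ℤ → ℤ × ℤ × ℤ} {ε δS βS ϑ aLo aHi : ℝ} {x₀ : E3} {x : ℤ × ℤ × ℤ}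
    (hΨ : IsBarlowBondChart S Set.univ Ψ τ) (hclean : ∀ p ∈ S, IsTwoShellGoodSet (1 / 16) (9 / 10) 1 S p)
    (hsepS : ∀ p ∈ S, ∀ p' ∈ S, p ≠ p' → δS ≤ dist p p') (hε : 2 * ε < δS)
    (hgapS : ∀ p ∈ S, ∀ p' ∈ S, IsBond p p' → dist p p' ≤ βS) (hβS : βS + 2 * ε ≤ 28 / 25)
    (hΦ : IsBarlowBondChart C D Φ τ') (hxD : g x ∈ D) (hxd : dist (Ψ x) (Φ (g x)) ≤ ε)
    (hgood : IsTwoShellGoodSet ϑ aLo aHi C (Φ (g x))) (hϑ : 0 ≤ ϑ) (haLo : 0 < aLo) (hbond : aHi * (1 + 2 * ϑ) ≤ 28 / 25)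
    (hcov : ∀ n ∈ C, IsBond (Φ (g x)) n → ∃ y ∈ D, Φ y = n)
    (hlo : aHi * (1 + ϑ) + 2 * ε < 9 / 10 * (Real.sqrt 2 - 1 / 16)) (hlo' : 28 / 25 + 2 * ε < 9 / 10 * (Real.sqrt 2 - 1 / 16))
    (hhi : 1 * (Real.sqrt 2 + 1 / 16) + 2 * ε ≤ 3 / 2 * aLo)
    (hP : ∀ y ∈ P, g y = Θ y ∧ g y ∈ D ∧ dist (Ψ y) (Φ (g y)) ≤ ε)
    (hiso : ∀ y y' : ℤ × ℤ × ℤ, y ∈ N → (BarlowAdj τ y y' ↔ BarlowAdj τ' (Θ y) (Θ y')))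
    (hsurj : ∀ y ∈ N, ∀ v : ℤ × ℤ × ℤ, BarlowAdj τ' (Θ y) v → ∃ y', Θ y' = v)
    (hN1 : ∀ i, linkPt τ x i ∈ N) (hN2 : ∀ i j, linkPt τ (linkPt τ x i) j ∈ N)
    (hN3 : ∀ i j k, linkPt τ (linkPt τ (linkPt τ x i) j) k ∈ N)
    (hw : Ψ x ≠ x₀)
    (hcone : ∀ y : ℤ × ℤ × ℤ, 1 / 2 * (‖Ψ y - Ψ x‖ * ‖Ψ x - x₀‖) ≤ ⟪Ψ y - Ψ x, Ψ x - x₀⟫ →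
      0 < dist (Ψ y) (Ψ x) → dist (Ψ y) (Ψ x) ≤ 43 / 20 → y ∈ P) :
    g x = Θ x := by
  have hw' : Ψ x - x₀ ≠ 0 := sub_ne_zero.2 hw
  obtain ⟨a, F, w', cs, ha, ha1, hn, hFw, hcell, hCAP, hF1, hF2, hσ1, hσ2⟩ :=
    cell_at_site hΨ (Set.mem_univ x) (fun _ => Set.mem_univ _) (fun _ _ => Set.mem_univ _) hclean hw'
  -- (1) first-shell members: link sites of `x`, processed, inside `N`
  have hP1 : ∀ m ∈ cellSigma1 (letters4 (τ (x.1 - 2)) (τ (x.1 - 1)) (τ x.1) (τ (x.1 + 1))) cs,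
      BarlowAdj τ x (x + m) ∧ x + m ∈ P ∧ x + m ∈ N := by
    intro m hm
    obtain ⟨i, hi, hcone', hdist⟩ := hσ1 m hm
    have hadj : BarlowAdj τ x (x + m) := by rw [hi]; exact barlowAdj_linkPt τ x i
    have hpos : 0 < dist (Ψ (x + m)) (Ψ x) := by
      rw [dist_comm]; exact ((hΨ.2.2 x (Set.mem_univ _) (x + m) (Set.mem_univ _)).2 hadj).1
    exact ⟨hadj, hcone _ hcone' hpos (by linarith), by rw [hi]; exact hN1 i⟩
  -- (2) second-shell members: orthogonal two-step sites of `x`, processed, inside `N`, in the S-distance window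
  have hP2 : ∀ m' ∈ cellSigma2 (letters4 (τ (x.1 - 2)) (τ (x.1 - 1)) (τ x.1) (τ (x.1 + 1))) cs,
      x + m' ∈ P ∧ x + m' ∈ N ∧ (∃ i j : Fin 12, x + m' = linkPt τ (linkPt τ x i) j) ∧
        9 / 10 * (Real.sqrt 2 - 1 / 16) ≤ dist (Ψ x) (Ψ (x + m')) ∧ dist (Ψ x) (Ψ (x + m')) ≤ 1 * (Real.sqrt 2 + 1 / 16) := by
    intro m' hm'
    obtain ⟨-, -, -, hcone', hdist⟩ := hσ2 m' hm'
    obtain ⟨i, j, horth, hij, -⟩ := shell2_cover (τ (x.1 - 2)) (τ (x.1 - 1)) (τ x.1) (τ (x.1 + 1)) m' (mem_cellSigma2.1 hm').1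
    have he : x + m' = linkPt τ (linkPt τ x i) j := by rw [linkPt_linkPt_eq_add_letters4, hij]
    have hpl := hF2 i j horth
    rw [← he] at hpl
    obtain ⟨hwlo, hwhi⟩ := dist_window_of_secondShell (aLo := 9 / 10) (aHi := 1) (θ := 1 / 16) (by norm_num) ha ha1 (by norm_num)
      (by norm_num) (norm_iotaPt_add_of_orth horth) hpl
    have hpos : 0 < dist (Ψ (x + m')) (Ψ x) := by
      have h2 := sqrt_two_bounds.1
      rw [dist_comm]; linarith
    exact ⟨hcone _ hcone' hpos (by linarith), by rw [he]; exact hN2 i j, ⟨i, j, he⟩, hwlo, hwhi⟩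
  -- (3) partners of the members in the C-lattice
  have hA1 : ∀ m ∈ cellSigma1 (letters4 (τ (x.1 - 2)) (τ (x.1 - 1)) (τ x.1) (τ (x.1 + 1))) cs, BarlowAdj τ' (g x) (Θ (x + m)) := by
    intro m hm
    obtain ⟨hadj, hyP, -⟩ := hP1 m hm
    obtain ⟨hg, hyD, hyd⟩ := hP _ hyP
    rw [← hg]
    exact barlowAdj_partner hΨ hΦ hsepS hε hgapS hβS hxD hyD hxd hyd hadj
  have hA2 : ∀ m' ∈ cellSigma2 (letters4 (τ (x.1 - 2)) (τ (x.1 - 1)) (τ x.1) (τ (x.1 + 1))) cs, BarlowFour τ' (g x) (Θ (x + m')) := by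
    intro m' hm'
    obtain ⟨hyP, -, -, hwlo, hwhi⟩ := hP2 m' hm'
    obtain ⟨hg, hyD, hyd⟩ := hP _ hyP
    rw [← hg]
    exact barlowFour_partner hΦ hxD hyD hxd hyd hgood hϑ haLo hbond hcov hwlo hwhi hlo hlo' hhi
  -- (4) the Θ-preimage `xs` of `g x`, through a first-shell member
  obtain ⟨m₀, hm₀⟩ := List.exists_mem_of_ne_nil _ (cellSigma1_ne_nil hcell)
  obtain ⟨-, -, hm₀N⟩ := hP1 m₀ hm₀
  obtain ⟨xs, hxs⟩ := hsurj (x + m₀) hm₀N (g x) (barlowAdj_symm (hA1 m₀ hm₀))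
  -- (5) the member relations pulled back to the S-lattice at `xs`
  have hB1 : ∀ m ∈ cellSigma1 (letters4 (τ (x.1 - 2)) (τ (x.1 - 1)) (τ x.1) (τ (x.1 + 1))) cs, BarlowAdj τ xs (x + m) := by
    intro m hm
    obtain ⟨-, -, hmN⟩ := hP1 m hm
    have h := hA1 m hm
    rw [← hxs] at h
    exact barlowAdj_symm ((hiso (x + m) xs hmN).2 (barlowAdj_symm h))
  have hB2 : ∀ m' ∈ cellSigma2 (letters4 (τ (x.1 - 2)) (τ (x.1 - 1)) (τ x.1) (τ (x.1 + 1))) cs, BarlowFour τ xs (x + m') := by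
    intro m' hm'
    obtain ⟨-, hyN, ⟨i, j, he⟩, -, -⟩ := hP2 m' hm'
    obtain ⟨hne, hnadj, T, hT4, hT⟩ := hA2 m' hm'
    rw [← hxs] at hne hnadj hT
    refine ⟨fun h => hne (by rw [h]), fun h => hnadj (barlowAdj_symm ((hiso (x + m') xs hyN).1 (barlowAdj_symm h))), ?_⟩
    have hpre : ∀ v ∈ T, ∃ v' : ℤ × ℤ × ℤ, Θ v' = v := fun v hv => hsurj (x + m') hyN v (hT v hv).2
    choose pre hpre using hpre
    classical
    have hinj : Function.Injective (fun v : {v // v ∈ T} => pre v.1 v.2) := by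
      intro v v' h
      apply Subtype.ext
      have h' := congrArg Θ h
      simp only at h'
      rwa [hpre v.1 v.2, hpre v'.1 v'.2] at h'
    refine ⟨T.attach.image (fun v => pre v.1 v.2), ?_, ?_⟩
    · rw [Finset.card_image_of_injective _ hinj, Finset.card_attach]
      exact hT4
    · intro v' hv'
      obtain ⟨v, -, rfl⟩ := Finset.mem_image.1 hv'
      obtain ⟨h1, h2⟩ := hT v.1 v.2
      rw [← hpre v.1 v.2] at h1 h2
      have h2' : BarlowAdj τ (x + m') (pre v.1 v.2) := (hiso (x + m') _ hyN).2 h2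
      obtain ⟨k, hk⟩ := exists_linkPt_of_barlowAdj h2'
      have hvN : pre v.1 v.2 ∈ N := by rw [hk, he]; exact hN3 i j k
      exact ⟨barlowAdj_symm ((hiso _ xs hvN).2 (barlowAdj_symm h1)), h2'⟩
  -- (6) the kernel-checked cell test: `xs = x`, or `xs − x` is an allowed competitor — which the processed cone excludes
  rcases pin_sound_abs (v := x) (A := cellAllowed (letters4 (τ (x.1 - 2)) (τ (x.1 - 1)) (τ x.1) (τ (x.1 + 1))) cs) hcell
      (fun m hm => shell1_fst _ m (mem_cellSigma1.1 hm).1) (fun m hm => shell2_fst _ _ _ _ m (mem_cellSigma2.1 hm).1) hB1 hB2 with hEq | hmem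
  · rw [hEq] at hxs
    exact hxs.symm
  · obtain ⟨hcone', hlo27, hhi17⟩ :=
      competitor_cone hΨ (fun _ => Set.mem_univ _) (fun _ _ => Set.mem_univ _) hclean ha hn hFw hF1 rfl hCAP hmem
    rw [add_sub_cancel] at hcone' hlo27 hhi17
    obtain ⟨hg, -, hd⟩ := hP xs (hcone xs hcone' (by linarith) (by linarith))
    have hxx : xs = x := eq_of_partner_eq hΨ hsepS hε hd hxd (by rw [hg, hxs])
    rw [hxx] at hg
    exact hg

end Summit.AtomisticToContinuum.Crystallization.Theorems.ChartedZeroExcessLayeredLatticeLiouville
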